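import Literature.Computability.MetaComplexity.SmolenskyParity
import HarnessLib

/-!
# Smolensky's character method over a field with a `q`-th root of unity

The algebra of Smolensky's 1987 lower bound for `MOD_q` against `AC⁰[p]` (`p ≠ q` primes), i.e. the
`q`-ary analogue of `SmolenskyProperty.lean` / `SmolenskyDimensionBound.lean` (which treat the
`±1`-valued parity character `Π (1 - 2xᵢ)`): over ANY field `F` and for any `ω ∈ F`, `ω ≠ 0, 1`,

* `Smolensky.omMono ω S = Π_{i ∈ S} ω^{xᵢ}` — the monomials in Smolensky's variables
  `yᵢ = 1 + (ω - 1)xᵢ ∈ {1, ω}`; `omMono ω univ = ω^{Σ xᵢ}` is the character (`omMono_univ_apply`);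
  expansions `omMono_eq_sum` (into monomials `x_U`), `sub_one_pow_smul_mono_eq_sum` (monomials into
  `ω`-monomials), `omMono_univ_mul_inv_compl` (a high `ω`-monomial is the character times a low
  `ω⁻¹`-monomial, since `yᵢ⁻¹ ∈ {1, ω⁻¹}` is again affine in `xᵢ`);
* **completeness** `map_mulLeft_omMono_sup_eq_top`: for `n` odd, `Y·L + L = ⊤` with
  `Y = omMono ω univ`, `L = lowDeg F n (n/2)` (Smolensky 1987, proof of Thm. 2: `MOD_q` is
  `U_F`-complete);
* **the dimension count** `two_pow_le_of_character_approx`: if `Y = Σ_s c_s u_s` with each `u_s`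
  agreeing off `E_s` with a polynomial function of degree `≤ D`, then
  `2ⁿ ≤ Σ_{i ≤ n/2 + D} C(n,i) + Σ_s |E_s|`;
* `comp_mem_lowDeg`: base change of `lowDeg` along a ring homomorphism `K →+* F`;
* **the one-length lower bound** `modq_residue_circuits_bound`: for a prime `p`, a ring map
  `ZMod p →+* F`, `ω^q = 1 ≠ ω`, `n` odd, and circuits over `accBasis p` of `acDepth ≤ d`, size
  `≤ S` computing ALL the residue indicators `[Σ xᵢ ≡ s (mod q)]`, `s < q`, on `n` bits: every
  `ℓ ≥ 1` with `64((p-1)ℓ)^{2d} ≤ n` has `3 p^ℓ ≤ 8 q S` (Razborov–Smolensky approximation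
  `razborov_smolensky` of each circuit, then the dimension count; cf. `smolensky_parity`).

The class-level consequence `MOD_q ∉ AC⁰[p]` (`Smolensky1987_modq_not_mem_AC0Mod_holds`) is in
`SmolenskyModq.lean`. Everything here is proved.

## References

* R. Smolensky, *Algebraic methods in the theory of lower bounds for Boolean circuit
  complexity*, Proc. 19th STOC (1987), 77–82, Thm. 2 and its proof, Lemma 5 [Smolensky1987].
* S. Jukna, *Boolean Function Complexity*, Springer 2012, §12.6, Lemma 12.26 / Thm. 12.27 (the
  case `q = 2`, `p = 3` of the same argument) [JuknaBFC2012].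
-/

noncomputable section

namespace Literature.Computability.MetaComplexity

open Finset Module Literature.Computability.Complexity

namespace Smolensky

variable {F : Type*} [Field F] {n : ℕ}

/-! ### `ω`-monomials: the character `Π ω^{xᵢ}` and its pieces -/

/-- The `ω`-monomial `Π_{i ∈ S} ω^{xᵢ}` on the cube (`xᵢ ∈ {0,1}`, so the factor is `ω` or `1`):
the monomial `Π_{i∈S} yᵢ` in Smolensky's variables `yᵢ = 1 + (ω - 1)xᵢ ∈ {1, ω}`; for `S = univ`
and `ω` a `q`-th root of unity it is the character `ω^{Σ xᵢ}`.
[cite: Smolensky1987, Thm. 2 (proof: the variables yᵢ, q-th roots of unity)] -/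
def omMono (ω : F) (S : Finset (Fin n)) : CubeFn F n :=
  fun b => ∏ i ∈ S, (if b i then ω else 1)

/-- `Π_{i∈S} ω^{bᵢ} = ω^{#{i ∈ S : bᵢ = 1}}`. [folklore] -/
theorem omMono_apply (ω : F) (S : Finset (Fin n)) (b : Fin n → Bool) :
    omMono ω S b = ω ^ (S.filter fun i => b i = true).card := by
  unfold omMono
  rw [Finset.prod_ite, Finset.prod_const_one, mul_one, Finset.prod_const]

/-- The full `ω`-monomial is the character `ω^{numOnes}`. [folklore] -/
theorem omMono_univ_apply (ω : F) (b : Fin n → Bool) :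
    omMono ω univ b = ω ^ GateFn.numOnes b := by
  rw [omMono_apply]; rfl

/-- Expansion into monomials: `Π_{i∈S} (1 + (ω-1)xᵢ) = Σ_{U ⊆ S} (ω-1)^{|U|} x_U`. [folklore] -/
theorem omMono_eq_sum (ω : F) (S : Finset (Fin n)) :
    omMono ω S = ∑ U ∈ S.powerset, ((ω - 1) ^ U.card) • mono F U := by
  funext b
  simp only [omMono, Finset.sum_apply, Pi.smul_apply, smul_eq_mul, mono]
  have h : ∀ i ∈ S, (if b i then ω else (1 : F)) = 1 + (ω - 1) * (if b i then (1 : F) else 0) :=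
    fun i _ => by split <;> ring
  rw [Finset.prod_congr rfl h, Finset.prod_one_add]
  refine Finset.sum_congr rfl fun U _ => ?_
  rw [Finset.prod_mul_distrib, Finset.prod_const]

/-- An `ω`-monomial of degree `≤ D` lies in `lowDeg D`. [folklore] -/
theorem omMono_mem_lowDeg (ω : F) {S : Finset (Fin n)} {D : ℕ} (h : S.card ≤ D) :
    omMono ω S ∈ lowDeg F n D := by
  rw [omMono_eq_sum]
  refine Submodule.sum_mem _ fun U hU => Submodule.smul_mem _ _ (mono_mem_lowDeg ?_)
  exact (Finset.card_le_card (Finset.mem_powerset.1 hU)).trans h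

/-- On the cube, `yᵢ⁻¹` is again an `ω⁻¹`-variable, so a high `ω`-monomial is the character times
a low `ω⁻¹`-monomial: `(Π_{all i} ω^{bᵢ}) · Π_{i ∉ S} ω^{-bᵢ} = Π_{i ∈ S} ω^{bᵢ}`.
[cite: Smolensky1987, Thm. 2 (proof)] -/
theorem omMono_univ_mul_inv_compl {ω : F} (hω : ω ≠ 0) (S : Finset (Fin n)) :
    omMono ω univ * omMono ω⁻¹ Sᶜ = omMono ω S := by
  funext b
  simp only [Pi.mul_apply, omMono]
  rw [← Finset.prod_mul_prod_compl S (fun i => if b i then ω else (1 : F)), mul_assoc,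
    ← Finset.prod_mul_distrib]
  have h1 : ∏ i ∈ Sᶜ, ((if b i then ω else (1 : F)) * (if b i then ω⁻¹ else 1)) = 1 :=
    Finset.prod_eq_one fun i _ => by split <;> simp [hω]
  rw [h1, mul_one]

/-- Expansion of a monomial into `ω`-monomials: `(ω-1)^{|T|} x_T = Π_{i∈T} (yᵢ - 1)
= Σ_{U ⊆ T} (-1)^{|T \ U|} Π_{i∈U} yᵢ`. [folklore] -/
theorem sub_one_pow_smul_mono_eq_sum (ω : F) (T : Finset (Fin n)) :
    (ω - 1) ^ T.card • mono F T = ∑ U ∈ T.powerset, ((-1 : F) ^ (T \ U).card) • omMono ω U := by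
  funext b
  simp only [Pi.smul_apply, smul_eq_mul, Finset.sum_apply, mono, omMono]
  have h2 : ∀ i ∈ T, (ω - 1) * (if b i then (1 : F) else 0) = (if b i then ω else 1) + (-1) :=
    fun i _ => by split <;> ring
  calc (ω - 1) ^ T.card * ∏ i ∈ T, (if b i then (1 : F) else 0)
      = ∏ i ∈ T, ((ω - 1) * (if b i then (1 : F) else 0)) := by
        rw [Finset.prod_mul_distrib, Finset.prod_const]
    _ = ∏ i ∈ T, ((if b i then ω else 1) + (-1 : F)) := Finset.prod_congr rfl h2
    _ = ∑ U ∈ T.powerset, (∏ i ∈ U, (if b i then ω else (1 : F))) * ∏ i ∈ T \ U, (-1 : F) :=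
        Finset.prod_add _ _ T
    _ = ∑ U ∈ T.powerset, (-1 : F) ^ (T \ U).card * ∏ i ∈ U, (if b i then ω else (1 : F)) :=
        Finset.sum_congr rfl fun U _ => by rw [Finset.prod_const, mul_comm]

/-- **Completeness of the character `Y = Π ω^{xᵢ}`** (Smolensky 1987, proof of Thm. 2; the
`q`-ary analogue of `map_mulLeft_parity_sup_eq_top`): for `n` odd and `ω ≠ 0, 1`, with
`L = lowDeg F n (n/2)`, `Y · L + L = ⊤` — every monomial is a combination of `ω`-monomials, each
of degree `≤ n/2` or equal to `Y` times an `ω⁻¹`-monomial of degree `≤ n/2`.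
[cite: Smolensky1987, Thm. 2 (proof: MOD_q is U_F-complete)] -/
theorem map_mulLeft_omMono_sup_eq_top (hn : Odd n) {ω : F} (hω0 : ω ≠ 0) (hω1 : ω ≠ 1) :
    (lowDeg F n (n / 2)).map (LinearMap.mulLeft F (omMono ω univ)) ⊔ lowDeg F n (n / 2) = ⊤ := by
  refine top_le_iff.1 ?_
  rw [← span_range_mono_eq_top, Submodule.span_le]
  rintro _ ⟨T, rfl⟩
  have hω1' : (ω - 1) ^ T.card ≠ 0 := pow_ne_zero _ (sub_ne_zero.2 hω1)
  have hT : mono F T = ((ω - 1) ^ T.card)⁻¹ • ((ω - 1) ^ T.card • mono F T) := by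
    rw [smul_smul, inv_mul_cancel₀ hω1', one_smul]
  rw [SetLike.mem_coe, hT, sub_one_pow_smul_mono_eq_sum]
  refine Submodule.smul_mem _ _ (Submodule.sum_mem _ fun U _ => Submodule.smul_mem _ _ ?_)
  by_cases hU : U.card ≤ n / 2
  · exact Submodule.mem_sup_right (omMono_mem_lowDeg ω hU)
  · refine Submodule.mem_sup_left ?_
    rw [← omMono_univ_mul_inv_compl hω0 U]
    refine Submodule.mem_map_of_mem (f := LinearMap.mulLeft F (omMono ω univ)) ?_
    refine omMono_mem_lowDeg ω⁻¹ ?_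
    rw [Finset.card_compl, Fintype.card_fin]
    obtain ⟨m, rfl⟩ := hn
    omega

/-! ### The dimension count for a character spread over several approximated pieces -/

/-- **Smolensky's dimension count, `q`-ary form.** Let `n` be odd, `ω ≠ 0, 1`, and suppose the
character `Y = Π ω^{xᵢ}` is a combination `Y = Σ_s c_s · u_s` of functions `u_s` each agreeing
outside a finite set `E_s` with a polynomial function `P_s` of degree `≤ D`. Then
`2ⁿ ≤ Σ_{i ≤ n/2 + D} C(n, i) + Σ_s |E_s|` (since `⊤ = Y·L + L ⊆ lowDeg (n/2 + D) + F^{⋃ E_s}`).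
(Smolensky 1987, proof of Thm. 1–2: "if we ignore the assignments where `g` differs from `f` … we
get a smaller algebra … of dimension `2ⁿ⁻¹ + o(2ⁿ)`".) [cite: Smolensky1987, Thms. 1–2 (proof)] -/
theorem two_pow_le_of_character_approx (hn : Odd n) {ω : F} (hω0 : ω ≠ 0) (hω1 : ω ≠ 1)
    {ι : Type*} (s : Finset ι) (c : ι → F) (u : ι → CubeFn F n)
    (hY : omMono ω univ = ∑ j ∈ s, c j • u j) {D : ℕ} (P : ι → CubeFn F n)
    (hP : ∀ j ∈ s, P j ∈ lowDeg F n D) (E : ι → Finset (Fin n → Bool))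
    (hE : ∀ j ∈ s, ∀ b, b ∉ E j → u j b = P j b) :
    2 ^ n ≤ (∑ i ∈ range (n / 2 + D + 1), n.choose i) + ∑ j ∈ s, (E j).card := by
  classical
  set E' : Finset (Fin n → Bool) := s.biUnion E with hE'
  have hle : (lowDeg F n (n / 2)).map (LinearMap.mulLeft F (omMono ω univ)) ⊔ lowDeg F n (n / 2) ≤
      lowDeg F n (n / 2 + D) ⊔ suppOn F E' := by
    refine sup_le ?_ (le_sup_of_le_left (lowDeg_mono (Nat.le_add_right _ _)))
    rw [lowDeg_eq_span (D := n / 2), Submodule.map_span_le]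
    rintro _ ⟨⟨S, hS⟩, rfl⟩
    dsimp only
    rw [LinearMap.mulLeft_apply, hY, Finset.sum_mul]
    refine Submodule.sum_mem _ fun j hj => ?_
    rw [smul_mul_assoc]
    refine Submodule.smul_mem _ _ ?_
    have hsplit : u j * mono F S = P j * mono F S + (u j - P j) * mono F S := by
      rw [sub_mul, add_sub_cancel]
    rw [hsplit]
    refine Submodule.add_mem _ (Submodule.mem_sup_left ?_) (Submodule.mem_sup_right ?_)
    · have := mul_mem_lowDeg_add (hP j hj) (mono_mem_lowDeg (F := F) hS)
      rwa [Nat.add_comm] at this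
    · refine mem_suppOn_of_forall fun b hb => ?_
      have hb' : b ∉ E j := fun h => hb (Finset.mem_biUnion.2 ⟨j, hj, h⟩)
      rw [Pi.mul_apply, Pi.sub_apply, hE j hj b hb', sub_self, zero_mul]
  rw [map_mulLeft_omMono_sup_eq_top hn hω0 hω1] at hle
  have h1 := Submodule.finrank_mono hle
  rw [finrank_top, finrank_cubeFn] at h1
  refine h1.trans ((Submodule.finrank_add_le_finrank_add_finrank _ _).trans ?_)
  refine Nat.add_le_add (finrank_lowDeg_le _) ((finrank_suppOn_le E').trans ?_)
  exact Finset.card_biUnion_le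

/-! ### Base change of low-degree polynomial functions along a field embedding -/

/-- Composition with a ring homomorphism `φ : K →+* F` maps `lowDeg K n D` into `lowDeg F n D`
(monomials go to monomials). [folklore] -/
theorem comp_mem_lowDeg {K : Type*} [Field K] (φ : K →+* F) {D : ℕ} {P : CubeFn K n}
    (hP : P ∈ lowDeg K n D) : (fun b => φ (P b)) ∈ lowDeg F n D := by
  rw [lowDeg_eq_span] at hP
  induction hP using Submodule.span_induction with
  | mem x hx =>
    obtain ⟨⟨S, hS⟩, rfl⟩ := hx
    have h : (fun b => φ (mono K S b)) = mono F S := by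
      funext b
      rw [mono_apply, mono_apply]
      split <;> simp
    rw [h]
    exact mono_mem_lowDeg hS
  | zero =>
    have h : (fun b => φ ((0 : CubeFn K n) b)) = 0 := by
      funext b; simp
    rw [h]
    exact Submodule.zero_mem _
  | add x y _ _ hx hy =>
    have h : (fun b => φ ((x + y) b)) = (fun b => φ (x b)) + fun b => φ (y b) := by
      funext b; simp
    rw [h]
    exact Submodule.add_mem _ hx hy
  | smul a x _ hx =>
    have h : (fun b => φ ((a • x) b)) = φ a • fun b => φ (x b) := by
      funext b; simp
    rw [h]
    exact Submodule.smul_mem _ _ hx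

/-! ### The lower bound for circuits computing all residues of `Σ xᵢ mod q` -/

/-- Powers of a `q`-th root of unity only depend on the exponent mod `q`. [folklore] -/
theorem pow_eq_pow_mod_of_pow_eq_one {ω : F} {q : ℕ} (hωq : ω ^ q = 1) (m : ℕ) :
    ω ^ m = ω ^ (m % q) := by
  conv_lhs => rw [← Nat.mod_add_div m q, pow_add, pow_mul, hωq, one_pow, mul_one]

/-- The character as a combination of the residue indicators:
`ω^{numOnes b} = Σ_{s < q} ω^s · [numOnes b ≡ s (mod q)]` for `ω^q = 1`, `0 < q`. [folklore] -/
theorem omMono_univ_eq_sum_indicator {ω : F} {q : ℕ} (hq : 0 < q) (hωq : ω ^ q = 1) :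
    omMono ω (univ : Finset (Fin n)) =
      ∑ s ∈ range q, (ω ^ s) • fun b => if GateFn.numOnes b % q = s then (1 : F) else 0 := by
  funext b
  rw [omMono_univ_apply, pow_eq_pow_mod_of_pow_eq_one hωq]
  simp only [Finset.sum_apply, Pi.smul_apply, smul_eq_mul, mul_ite, mul_one, mul_zero]
  rw [Finset.sum_ite_eq (range q) (GateFn.numOnes b % q) (fun s => ω ^ s), if_pos]
  exact Finset.mem_range.2 (Nat.mod_lt _ hq)

variable {p : ℕ} [Fact p.Prime]

/-- **Smolensky's lower bound for the residues of `Σ xᵢ mod q`, at one input length.** Let `p` be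
prime, `F` a field receiving `ZMod p` with an element `ω ≠ 1`, `ω^q = 1` (`0 < q`), `n` odd, and
suppose that for every residue `s < q` a circuit `C s` over `accBasis p` of `acDepth ≤ d` and size
`≤ S` computes `x ↦ [numOnes x ≡ s (mod q)]` on `n` bits. Then every `ℓ ≥ 1` with
`64 · ((p-1)ℓ)^{2d} ≤ n` satisfies `3 · p^ℓ ≤ 8 · q · S` (approximate each `C s` by a polynomial of
degree `((p-1)ℓ)^d` off `E_s`, `|E_s| p^ℓ ≤ S 2ⁿ`, and count dimensions:
`2ⁿ ≤ 2ⁿ⁻¹ + D·C(n,n/2) + Σ|E_s|`). [cite: Smolensky1987, Thm. 2 (proof)] -/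
theorem modq_residue_circuits_bound (φ : ZMod p →+* F) {ω : F} {q : ℕ} (hq : 0 < q)
    (hωq : ω ^ q = 1) (hω1 : ω ≠ 1) (hn : Odd n) {d S : ℕ} (C : ℕ → Circuit (Fin n))
    (hC : ∀ s < q, (C s).IsOver (accBasis p)) (hd : ∀ s < q, (C s).acDepth ≤ d)
    (hS : ∀ s < q, (C s).size ≤ S)
    (hcomp : ∀ s < q, ∀ x, (C s).eval x = decide (GateFn.numOnes x % q = s)) {ℓ : ℕ} (hℓ : 1 ≤ ℓ)
    (hℓn : 64 * ((p - 1) * ℓ) ^ (2 * d) ≤ n) : 3 * p ^ ℓ ≤ 8 * q * S := by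
  classical
  have hp := (Fact.out : p.Prime)
  have hω0 : ω ≠ 0 := by
    rintro rfl
    rw [zero_pow hq.ne'] at hωq
    exact zero_ne_one hωq
  have hM1 : 1 ≤ (p - 1) * ℓ := Nat.mul_pos (by have := hp.two_le; omega) hℓ
  set D : ℕ := ((p - 1) * ℓ) ^ d with hDdef
  -- approximate each residue circuit
  have happrox : ∀ s, s < q → ∃ (P : CubeFn F n) (E : Finset (Fin n → Bool)),
      P ∈ lowDeg F n D ∧ E.card * p ^ ℓ ≤ S * 2 ^ n ∧
        ∀ x, x ∉ E → (if GateFn.numOnes x % q = s then (1 : F) else 0) = P x := by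
    intro s hs
    obtain ⟨P, E, hP, hE, hPE⟩ := razborov_smolensky (C s) (hC s hs) hℓ
    refine ⟨fun b => φ (P b), E,
      comp_mem_lowDeg φ (lowDeg_mono (Nat.pow_le_pow_right hM1 (hd s hs)) hP),
      hE.trans (Nat.mul_le_mul_right _ (hS s hs)), fun x hx => ?_⟩
    dsimp only
    rw [hPE x hx, hcomp s hs x]
    by_cases h : GateFn.numOnes x % q = s
    · rw [if_pos h, decide_eq_true h, bit_true, map_one]
    · rw [if_neg h, decide_eq_false h, bit_false, map_zero]
  choose! P E hP hE hPE using happrox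
  -- the dimension count
  have hdim := two_pow_le_of_character_approx hn hω0 hω1 (range q) (fun s => ω ^ s)
    (fun s b => if GateFn.numOnes b % q = s then (1 : F) else 0)
    (omMono_univ_eq_sum_indicator hq hωq) P (fun s hs => hP s (Finset.mem_range.1 hs)) E
    (fun s hs b hb => hPE s (Finset.mem_range.1 hs) b hb)
  have hchoose := sum_range_choose_le hn D
  -- `Σ |E_s| p^ℓ ≤ q S 2ⁿ`
  have hEsum : (∑ s ∈ range q, (E s).card) * p ^ ℓ ≤ q * (S * 2 ^ n) := by
    rw [Finset.sum_mul]
    calc ∑ s ∈ range q, (E s).card * p ^ ℓ ≤ ∑ _s ∈ range q, S * 2 ^ n :=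
          Finset.sum_le_sum fun s hs => hE s (Finset.mem_range.1 hs)
      _ = q * (S * 2 ^ n) := by rw [Finset.sum_const, Finset.card_range, smul_eq_mul]
  -- `8 D C(n,n/2) ≤ 2ⁿ` from `64 D² ≤ n` and `C(n,n/2)² n ≤ 4ⁿ`
  have hDC : 8 * (D * n.choose (n / 2)) ≤ 2 ^ n := by
    have hsq : (8 * (D * n.choose (n / 2))) ^ 2 ≤ (2 ^ n) ^ 2 := by
      calc (8 * (D * n.choose (n / 2))) ^ 2
          = 64 * ((p - 1) * ℓ) ^ (2 * d) * n.choose (n / 2) ^ 2 := by rw [hDdef]; ring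
        _ ≤ n * n.choose (n / 2) ^ 2 := Nat.mul_le_mul_right _ hℓn
        _ = n.choose (n / 2) ^ 2 * n := by ring
        _ ≤ 4 ^ n := choose_half_sq_mul_le hn
        _ = (2 ^ n) ^ 2 := by rw [← pow_mul, mul_comm, pow_mul]; norm_num
    exact (Nat.pow_le_pow_iff_left two_ne_zero).1 hsq
  -- `2ⁿ = 2 · 2ⁿ⁻¹`
  have h2n : 2 ^ n = 2 * 2 ^ (n - 1) := by
    obtain ⟨m, rfl⟩ := hn
    rw [show 2 * m + 1 - 1 = 2 * m by omega, pow_succ]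
    ring
  have hppos : 0 < p ^ ℓ := pow_pos hp.pos ℓ
  have hApos : 0 < 2 ^ (n - 1) := pow_pos two_pos _
  -- combine: `2ⁿ p^ℓ ≤ (2ⁿ⁻¹ + D C + Σ|E|) p^ℓ ≤ (2ⁿ⁻¹ + DC) p^ℓ + q S 2ⁿ`
  have hmain : 2 ^ n * p ^ ℓ ≤
      (2 ^ (n - 1) + D * n.choose (n / 2)) * p ^ ℓ + q * (S * 2 ^ n) := by
    calc 2 ^ n * p ^ ℓ
        ≤ ((∑ i ∈ range (n / 2 + D + 1), n.choose i) + ∑ s ∈ range q, (E s).card) * p ^ ℓ :=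
          Nat.mul_le_mul_right _ hdim
      _ = (∑ i ∈ range (n / 2 + D + 1), n.choose i) * p ^ ℓ +
            (∑ s ∈ range q, (E s).card) * p ^ ℓ := by ring
      _ ≤ (2 ^ (n - 1) + D * n.choose (n / 2)) * p ^ ℓ + q * (S * 2 ^ n) :=
          Nat.add_le_add (Nat.mul_le_mul_right _ hchoose) hEsum
  -- arithmetic endgame in terms of `A = 2ⁿ⁻¹`, `Pw = p^ℓ`, `K = D C(n,n/2)`
  set A := 2 ^ (n - 1) with hA
  set Pw := p ^ ℓ with hPw
  set K := D * n.choose (n / 2) with hK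
  rw [h2n] at hmain hDC
  -- hDC : 8 K ≤ 2 A ; hmain : 2 A Pw ≤ (A + K) Pw + q (S (2A))
  have h3 : 3 * (A * Pw) ≤ 8 * q * S * A := by nlinarith [hmain, hDC, hppos, hApos]
  have h4 : 3 * Pw * A ≤ (8 * q * S) * A := by nlinarith [h3]
  exact Nat.le_of_mul_le_mul_right h4 hApos

end Smolensky

end Literature.Computability.MetaComplexity
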